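import Summits.NavierStokesRegularity.NavierStokesRegularity.Theorems.CoriolisHeadLocalEnergyDriftNormalForm
import Summits.NavierStokesRegularity.NavierStokesRegularity.Theorems.CoriolisHeadLocalEnergyRieszPressureBMO
import Literature.Analysis.FluidPDE.RieszPressureModConstPoisson
import Literature.Analysis.FluidPDE.HarmonicOfSmallStencil
import HarnessLib

/-!
# CoriolisHeadLocalEnergyDriftNormalFormClosed — crux `NoCoRotatingCore` (stmt-NavierStokesRegularity-22676), line
# `local_energy_rescue` (crux workfile v2.1, ns-idea-10 g3): stub S1 `stub_driftNormalForm` PROVED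

`CoriolisHead.stub_driftNormalForm` — the workfile's S1 verbatim (its local notation `E3` spelled out as
`EuclideanSpace ℝ (Fin 3)`): every bounded smooth rotated profile `(ν, a, B, U, P)` (ANY `ν, a > 0`, skew `B`) has a recentring
`U(· + y₀) − b` solving the same system with a pressure of bounded quadratic mean oscillation
(`∫_{B(z,ρ)} (P' − m)² ≤ K ρ³` for all balls).  In print: Koch–Nadirashvili–Seregin–Šverák 2009 §5 / Seregin 2014 Lemma 6.5,
Thm 2.6, Remark 6.3 (the pressure of a bounded ancient solution is `RᵢRⱼ(uᵢuⱼ) + b′(t)·x + c(t)`).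

Assembly (everything else is in the tree):
* `N := pressurePotentialMod 0 U`, the Riesz pressure of the bounded field `U` modulo constants
  (`Literature/Analysis/FluidPDE/RieszPressureModConst`), has `BMO₂` at all scales
  (`LocalEnergyRescue.exists_sq_oscillation_pressurePotentialMod_le`, file `…RieszPressureBMO`, assembled from the window pressure split
  of the route `PoloidalWindowDoor`);
* `P − N` is continuous and WEAKLY HARMONIC (`integral_sub_pressurePotentialMod_mul_laplacian`): `∫ N Δφ = −∫ D²φ(U,U)`
  (tree `integral_pressurePotentialMod_mul_laplacian`) and `∫ P Δφ = ∫ φ ΔP = −∫ φ tr(DU∘DU) = −∫ φ G[U] = −∫ D²φ(U,U)` (tree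
  `integral_mul_laplacian_comm`, `laplacian_pressure_eq_of_rotated`, `pressureSource_eq_of_isDivFree`, `divergence_convect_self_eq`,
  `integral_mul_pressureSource`); hence harmonic (tree Weyl lemma `harmonicOnNhd_of_continuousOn_of_weaklyHarmonic`), hence smooth
  (`contDiff_of_harmonicOnNhd_univ`) with `Δ(P − N) = 0`; so `N` is smooth with `ΔN = ΔP` (`P` is smooth by `contDiff_pressure_of_rotated`);
* `driftNormalForm_of_rieszPressure` (file `…DriftNormalForm`: bounded harmonic gradient ⇒ `P − N` affine; recentring by the symmetry
  of the profile system) concludes.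

HONEST FRAMING.  This proves stub S1 of an UNREGISTERED rescue line as a helper theorem on the crux item; S2 and S3b of the same line
are in the tree (`stub_densityBootstrap`, `stub_decayOfTopNull`); S3a (`stub_localEnergyClass`, the CKN class) and R1 (Pineau–Vicol
Conjecture 1.1 as printed) remain OPEN.  `NoCoRotatingCore`, the summit, and NS regularity are NOT proved here.

References: G. Koch, N. Nadirashvili, G. Seregin, V. Šverák, Acta Math. 203 (2009) [KochNadirashviliSereginSverak2009]; G. Seregin,
*Lecture Notes on Regularity Theory for the Navier–Stokes Equations* (2014), §6.2 Lemma 6.5, §6.3 Def. 6.3 [Seregin2014];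
D. Gilbarg, N. Trudinger (2001), §2.3 (Weyl), Thm 2.10 [GilbargTrudinger2001].
-/

noncomputable section

open MeasureTheory Set Function Filter Topology Metric InnerProductSpace Real
open scoped RealInnerProductSpace Laplacian ContDiff Topology

-- the crux's namespace is already a prefix of the route's; silence the duplicate-namespace linter as the sibling files do
set_option linter.dupNamespace false

-- nested operator types `ℝ³ →L[ℝ] ℝ³ →L[ℝ] ℝ³ →L[ℝ] ℝ`
set_option maxSynthPendingDepth 3

namespace Summit.NavierStokesRegularity.NavierStokesRegularity.Theorems.CoriolisHead

namespace LocalEnergyRescue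

open Literature.Analysis Literature.Analysis.FluidPDE Literature.Analysis.PDE

section Profile

variable {ν a : ℝ} {B : EuclideanSpace ℝ (Fin 3) →L[ℝ] EuclideanSpace ℝ (Fin 3)}
  {U : EuclideanSpace ℝ (Fin 3) → EuclideanSpace ℝ (Fin 3)} {P : EuclideanSpace ℝ (Fin 3) → ℝ} {M : ℝ}

/-- **The pressure of a rotated profile, tested against `Δφ`**: `∫ P Δφ = −∫ D²φ(U, U)` for every test function `φ` — Green's second
identity, the pressure Poisson equation `ΔP = −tr (DU ∘ DU)` and `tr (DU ∘ DU) = G[U] = ∂ᵢ∂ⱼ(UᵢUⱼ)` for divergence-free `U`, then two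
integrations by parts (`integral_mul_pressureSource`). [cite: Seregin2014, §6.2 Lemma 6.5] -/
theorem integral_pressure_mul_laplacian (hU : ContDiff ℝ (⊤ : ℕ∞) U) (hP : ContDiff ℝ 2 P)
    (hdiv : VectorCalculus.IsDivFree U)
    (heq : ∀ y, -(ν • (Δ U) y) + a • U y + a • fderiv ℝ U y y + (B (U y) - fderiv ℝ U y (B y)) +
      convect U U y + gradient P y = 0)
    {φ : EuclideanSpace ℝ (Fin 3) → ℝ} (hφ : ContDiff ℝ (⊤ : ℕ∞) φ) (hφc : HasCompactSupport φ) :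
    ∫ x, P x * (Δ φ) x = -∫ x, fderiv ℝ (fderiv ℝ φ) x (U x) (U x) := by
  have hU2 : ContDiff ℝ 2 U := hU.of_le (by norm_cast)
  have hU3 : ContDiff ℝ 3 U := hU.of_le (by norm_cast)
  have hφ2 : ContDiff ℝ 2 φ := hφ.of_le (by norm_cast)
  -- Green's second identity
  have h1 : ∫ x, P x * (Δ φ) x = ∫ x, φ x * (Δ P) x := by
    rw [integral_mul_laplacian_comm hP hφ2 hφc]
    exact integral_congr_ae (Eventually.of_forall fun x => mul_comm _ _)
  -- the pressure Poisson equation, `ΔP = −G[U]`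
  have hΔP : ∀ x, (Δ P) x = -pressureSource U x := fun x => by
    rw [laplacian_pressure_eq_of_rotated hU3 hP hdiv heq x, pressureSource_eq_of_isDivFree hdiv,
      divergence_convect_self_eq hU2 hdiv x]
  rw [h1]
  simp_rw [hΔP, mul_neg, integral_neg]
  rw [integral_mul_pressureSource hφ2 hφc hU2]

/-- **`P − Q̃` is weakly harmonic**: with `Q̃ = pressurePotentialMod x₀ U` the Riesz pressure of the bounded profile modulo constants,
`∫ (P − Q̃) Δφ = 0` for every test function (`integral_pressure_mul_laplacian` and the tree's weak Poisson equation
`integral_pressurePotentialMod_mul_laplacian`). [cite: Seregin2014, §6.2 Lemma 6.5] -/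
theorem integral_sub_pressurePotentialMod_mul_laplacian (hU : ContDiff ℝ (⊤ : ℕ∞) U) (hP : ContDiff ℝ 2 P)
    (hdiv : VectorCalculus.IsDivFree U)
    (heq : ∀ y, -(ν • (Δ U) y) + a • U y + a • fderiv ℝ U y y + (B (U y) - fderiv ℝ U y (B y)) +
      convect U U y + gradient P y = 0)
    (hM : ∀ y, ‖U y‖ ≤ M) (x₀ : EuclideanSpace ℝ (Fin 3))
    {φ : EuclideanSpace ℝ (Fin 3) → ℝ} (hφ : ContDiff ℝ (⊤ : ℕ∞) φ) (hφc : HasCompactSupport φ) :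
    ∫ x, (P x - pressurePotentialMod x₀ U x) * (Δ φ) x = 0 := by
  have hU4 : ContDiff ℝ 4 U := hU.of_le (by norm_cast)
  have hφ2 : ContDiff ℝ 2 φ := hφ.of_le (by norm_cast)
  have hΔφc : Continuous (Δ φ) := FluidPDE.continuous_laplacian hφ2
  have hΔφs : HasCompactSupport (Δ φ) := hφc.mono' fun x hx => by
    contrapose! hx
    simp [FluidPDE.laplacian_eq_zero_of_notMem_tsupport hx]
  have hQc : Continuous (pressurePotentialMod x₀ U) := continuous_pressurePotentialMod (hU.of_le (by norm_cast)) hM x₀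
  have hiP : Integrable fun x => P x * (Δ φ) x :=
    (hP.continuous.mul hΔφc).integrable_of_hasCompactSupport hΔφs.mul_left
  have hiQ : Integrable fun x => pressurePotentialMod x₀ U x * (Δ φ) x :=
    (hQc.mul hΔφc).integrable_of_hasCompactSupport hΔφs.mul_left
  simp_rw [sub_mul]
  rw [integral_sub hiP hiQ, integral_pressure_mul_laplacian hU hP hdiv heq hφ hφc,
    integral_pressurePotentialMod_mul_laplacian hU4 hM x₀ hφ hφc, sub_self]

/-- **The Riesz pressure of a bounded rotated profile is smooth with `ΔQ̃ = ΔP`.**  `P − Q̃` is continuous and weakly harmonic,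
hence harmonic by Weyl's lemma (tree `harmonicOnNhd_of_continuousOn_of_weaklyHarmonic`), hence smooth with vanishing Laplacian;
and `P` itself is smooth (`contDiff_pressure_of_rotated`). [cite: GilbargTrudinger2001, §2.3 (Weyl's lemma)] -/
theorem contDiff_pressurePotentialMod_of_rotatedProfile (hU : ContDiff ℝ (⊤ : ℕ∞) U) (hP : ContDiff ℝ 2 P)
    (hdiv : VectorCalculus.IsDivFree U)
    (heq : ∀ y, -(ν • (Δ U) y) + a • U y + a • fderiv ℝ U y y + (B (U y) - fderiv ℝ U y (B y)) +
      convect U U y + gradient P y = 0)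
    (hM : ∀ y, ‖U y‖ ≤ M) (x₀ : EuclideanSpace ℝ (Fin 3)) :
    ContDiff ℝ (⊤ : ℕ∞) (pressurePotentialMod x₀ U) ∧
      ∀ y, (Δ (pressurePotentialMod x₀ U)) y = (Δ P) y := by
  have hPs : ContDiff ℝ (⊤ : ℕ∞) P := contDiff_pressure_of_rotated hU (hP.of_le (by norm_cast)) heq
  have hQc : Continuous (pressurePotentialMod x₀ U) := continuous_pressurePotentialMod (hU.of_le (by norm_cast)) hM x₀
  set g : EuclideanSpace ℝ (Fin 3) → ℝ := fun x => P x - pressurePotentialMod x₀ U x with hg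
  have hgc : Continuous g := hPs.continuous.sub hQc
  have hharm : HarmonicOnNhd g univ :=
    harmonicOnNhd_of_continuousOn_of_weaklyHarmonic isOpen_univ hgc.continuousOn
      fun φ hφ hφc _ => integral_sub_pressurePotentialMod_mul_laplacian hU hP hdiv heq hM x₀ hφ hφc
  have hgs : ContDiff ℝ (⊤ : ℕ∞) g := contDiff_of_harmonicOnNhd_univ hharm
  have hΔg : ∀ y, (Δ g) y = 0 := fun y => (hharm y (mem_univ y)).2.eq_of_nhds
  have hQeq : pressurePotentialMod x₀ U = fun x => P x - g x := by
    funext x; simp [hg]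
  refine ⟨by rw [hQeq]; exact hPs.sub hgs, fun y => ?_⟩
  have h1 : ContDiffAt ℝ 2 P y := (hPs.of_le (by norm_cast)).contDiffAt
  have h2 : ContDiffAt ℝ 2 g y := (hgs.of_le (by norm_cast)).contDiffAt
  rw [hQeq, show (fun x => P x - g x) = P - g from rfl, h1.laplacian_sub h2, hΔg y, sub_zero]

/-- **The Riesz-pressure input of `driftNormalForm_of_rieszPressure`, DISCHARGED**: every bounded smooth rotated profile admits a smooth
`N` with `ΔN = ΔP` and `∫_{B(z,ρ)} (N − m)² ≤ K ρ³` on every ball — namely `N = pressurePotentialMod 0 U`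
(`contDiff_pressurePotentialMod_of_rotatedProfile`, `exists_sq_oscillation_pressurePotentialMod_le`).
[cite: Seregin2014, §6.2 Lemma 6.5] [cite: GrafakosMFA2009, Corollary 3.4.10] -/
theorem exists_rieszPressure_of_rotatedProfile (hU : ContDiff ℝ (⊤ : ℕ∞) U) (hP : ContDiff ℝ 2 P)
    (hdiv : VectorCalculus.IsDivFree U)
    (heq : ∀ y, -(ν • (Δ U) y) + a • U y + a • fderiv ℝ U y y + (B (U y) - fderiv ℝ U y (B y)) +
      convect U U y + gradient P y = 0)
    (hM : ∀ y, ‖U y‖ ≤ M) :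
    ∃ (N : EuclideanSpace ℝ (Fin 3) → ℝ) (K : ℝ), ContDiff ℝ (⊤ : ℕ∞) N ∧
      (∀ y, (Δ N) y = (Δ P) y) ∧
      ∀ (z : EuclideanSpace ℝ (Fin 3)) (ρ : ℝ), 0 < ρ → ∃ m : ℝ, ∫ y in ball z ρ, (N y - m) ^ 2 ≤ K * ρ ^ 3 := by
  obtain ⟨κ, -, hκ⟩ := exists_sq_oscillation_pressurePotentialMod_le
  obtain ⟨hNs, hΔN⟩ := contDiff_pressurePotentialMod_of_rotatedProfile hU hP hdiv heq hM 0
  exact ⟨pressurePotentialMod 0 U, κ * M ^ 4, hNs, hΔN, fun z ρ hρ => hκ U M hU hM 0 z ρ hρ⟩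

end Profile

end LocalEnergyRescue

open LocalEnergyRescue Literature.Analysis.FluidPDE in
/-- **Stub S1 `stub_driftNormalForm` of the line `local_energy_rescue` (crux workfile v2.1), PROVED** — the workfile's statement
verbatim with its local notation `E3` spelled out as `EuclideanSpace ℝ (Fin 3)`.  For every bounded smooth rotated profile
(ANY `ν, a > 0`, skew `B`) some recentring `U(· + y₀) − b` solves the same system with a pressure of bounded quadratic mean
oscillation on all balls.  Proof: `driftNormalForm_of_rieszPressure` with the Riesz pressure `N = pressurePotentialMod 0 U`
(`exists_rieszPressure_of_rotatedProfile`: smooth, `ΔN = ΔP`, `BMO₂`).  S3a, R1, `NoCoRotatingCore` and NS regularity are NOT proved.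
[cite: KochNadirashviliSereginSverak2009, §5] [cite: Seregin2014, §6.2 Lemma 6.5, Thm 2.6, Remark 6.3] -/
theorem stub_driftNormalForm :
    ∀ (ν a : ℝ), 0 < ν → 0 < a → ∀ (B : EuclideanSpace ℝ (Fin 3) →L[ℝ] EuclideanSpace ℝ (Fin 3))
      (U : EuclideanSpace ℝ (Fin 3) → EuclideanSpace ℝ (Fin 3)) (P : EuclideanSpace ℝ (Fin 3) → ℝ),
      ContDiff ℝ (⊤ : ℕ∞) U → ContDiff ℝ 2 P → (∀ x, inner ℝ (B x) x = 0) →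
      Literature.Analysis.FluidPDE.VectorCalculus.IsDivFree U →
      (∀ y, -(ν • Laplacian.laplacian U y) + a • U y + a • fderiv ℝ U y y
        + (B (U y) - fderiv ℝ U y (B y)) + Literature.Analysis.FluidPDE.convect U U y
        + gradient P y = 0) →
      (∃ M : ℝ, ∀ y, ‖U y‖ ≤ M) →
      ∃ (y₀ b : EuclideanSpace ℝ (Fin 3)) (P' : EuclideanSpace ℝ (Fin 3) → ℝ) (K : ℝ),
        ContDiff ℝ (⊤ : ℕ∞) (fun y => U (y + y₀) - b) ∧ ContDiff ℝ 2 P' ∧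
        Literature.Analysis.FluidPDE.VectorCalculus.IsDivFree (fun y => U (y + y₀) - b) ∧
        (∀ y, -(ν • Laplacian.laplacian (fun y => U (y + y₀) - b) y) + a • (fun y => U (y + y₀) - b) y
          + a • fderiv ℝ (fun y => U (y + y₀) - b) y y
          + (B ((fun y => U (y + y₀) - b) y) - fderiv ℝ (fun y => U (y + y₀) - b) y (B y))
          + Literature.Analysis.FluidPDE.convect (fun y => U (y + y₀) - b) (fun y => U (y + y₀) - b) y
          + gradient P' y = 0) ∧
        (∃ M' : ℝ, ∀ y, ‖(fun y => U (y + y₀) - b) y‖ ≤ M') ∧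
        (∀ (z : EuclideanSpace ℝ (Fin 3)) (ρ : ℝ), 0 < ρ →
          ∃ m : ℝ, ∫ y in Metric.ball z ρ, (P' y - m) ^ 2 ≤ K * ρ ^ 3) := by
  intro ν a hν ha B U P hU hP hB hdiv heq hbdd
  obtain ⟨M, hM⟩ := hbdd
  exact driftNormalForm_of_rieszPressure ν a hν ha B U P hU hP hB hdiv heq ⟨M, hM⟩
    (exists_rieszPressure_of_rotatedProfile hU hP hdiv heq hM)

end Summit.NavierStokesRegularity.NavierStokesRegularity.Theorems.CoriolisHead

end
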